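import Mathlib.Analysis.CStarAlgebra.GelfandNaimarkSegal
import Mathlib.Analysis.Matrix.Order
import Literature.MathematicalPhysics.QuantumLattice.InfVolFermionState
import Literature.MathematicalPhysics.QuantumLattice.InfiniteVolumeStatesProofs
import Literature.MathematicalPhysics.QuantumLattice.HubbardGaugeBound
import HarnessLib

/-!
# Infinite-volume fermion states are positive on the cone and contractive

Topic `Literature/MathematicalPhysics/QuantumLattice`; namespace
`Literature.MathematicalPhysics.QuantumLattice` (the file path). Companion of
`InfVolFermionState.lean`: the fermionic twins of the spin-side discharges of
`InfiniteVolumeStatesProofs.lean`. Everything is PROVED; no definition, no named fact.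

## Results

* `InfVolFermionState.expect_nonneg_of_nonneg`: `0 ≤ A` (Loewner order, `open scoped MatrixOrder`)
  implies `0 ≤ ω_Λ(A)` — positivity on the whole cone, from positivity on the `Bᴴ B`
  (Bratteli–Robinson I, §2.3.2 remark after Def. 2.3.9; Mathlib's `Matrix.instStarOrderedRing`);
  `expect_re_nonneg_of_posSemidef`: the real part, for a positive semidefinite `A`.
* `InfVolFermionState.norm_expect_le`: **states are contractive**, `‖ω_Λ(A)‖ ≤ ‖A‖` in the
  L²-operator norm (Bratteli–Robinson I, Prop. 2.3.11: a positive linear functional on a unital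
  C⋆-algebra has norm `ω(𝟙)`; here via the tree's
  `PositiveLinearMap.norm_apply_le_of_map_one`); `abs_re_expect_le`: `|Re ω_Λ(A)| ≤ ‖A‖`.
* `norm_hoppingTerm_le`: the Hubbard bond observable
  `-t Σ_σ (c†_{xσ} c_{yσ} + c†_{yσ} c_{xσ})` has operator norm `≤ 4|t|`.

Deliberately NOT here: anything specific to the Hubbard interaction's regions (see
`InfVolFermionStateHubbardMeanEnergyBox.lean`).
-/

noncomputable section

namespace Literature.MathematicalPhysics.QuantumLattice

open Matrix Finset HubbardWave0 Literature.Probability.LatticeModels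
open scoped ComplexOrder

variable {d : ℕ}

namespace InfVolFermionState

variable (ω : InfVolFermionState d)

open scoped MatrixOrder in
/-- The local states are positive on the whole positive cone: `0 ≤ A → 0 ≤ ω_Λ(A)` for `A`
positive semidefinite (Loewner order). Bratteli–Robinson I, §2.3.2, remark after Def. 2.3.9
(every positive element is a `Bᴴ B`; for matrices the cone is the closed additive span of the
`Bᴴ B`, along which positivity propagates by additivity). [cite: BratteliRobinsonI1987, Def. 2.3.9] -/
theorem expect_nonneg_of_nonneg (Λ : Finset (Site d)) {A : FermionOp Λ} (hA : 0 ≤ A) :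
    0 ≤ ω.expect Λ A := by
  rw [StarOrderedRing.nonneg_iff] at hA
  induction hA using AddSubmonoid.closure_induction with
  | mem x hx =>
    obtain ⟨B, rfl⟩ := hx
    exact ω.expect_nonneg Λ B
  | zero => simp
  | add x y _ _ hx hy =>
    rw [map_add]
    exact add_nonneg hx hy

open scoped MatrixOrder in
/-- For a positive semidefinite local observable, `Re ω_Λ(A) ≥ 0`. [cite: BratteliRobinsonI1987, Def. 2.3.9] -/
theorem expect_re_nonneg_of_posSemidef (Λ : Finset (Site d)) {A : FermionOp Λ} (hA : A.PosSemidef) :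
    0 ≤ (ω.expect Λ A).re :=
  (Complex.nonneg_iff.1 (ω.expect_nonneg_of_nonneg Λ (Matrix.nonneg_iff_posSemidef.2 hA))).1

open scoped MatrixOrder Matrix.Norms.L2Operator in
/-- **States are contractive**: `‖ω_Λ(A)‖ ≤ ‖A‖` (L²-operator norm) for every region `Λ` and every
local observable `A`, from positivity and normalisation of `ω_Λ`. Bratteli–Robinson I,
Prop. 2.3.11 with Lemma 2.3.10 (a positive linear functional on a unital C⋆-algebra is continuous
with `‖ω‖ = ω(𝟙)`), applied to `ω_Λ` as a Mathlib `PositiveLinearMap` on the finite-dimensional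
C⋆-algebra `𝔄_Λ`. [cite: BratteliRobinsonI1987, Prop. 2.3.11] -/
theorem norm_expect_le (Λ : Finset (Site d)) (A : FermionOp Λ) : ‖ω.expect Λ A‖ ≤ ‖A‖ := by
  letI : CStarAlgebra (FermionOp Λ) := {}
  exact Literature.MathematicalPhysics.QuantumLattice.PositiveLinearMap.norm_apply_le_of_map_one
    (.mk₀ (ω.expect Λ) fun _ hB => ω.expect_nonneg_of_nonneg Λ hB) (ω.expect_one Λ) A

open scoped Matrix.Norms.L2Operator in
/-- `|Re ω_Λ(A)| ≤ ‖A‖`. [cite: BratteliRobinsonI1987, Prop. 2.3.11] -/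
theorem abs_re_expect_le (Λ : Finset (Site d)) (A : FermionOp Λ) : |(ω.expect Λ A).re| ≤ ‖A‖ :=
  (Complex.abs_re_le_norm _).trans (ω.norm_expect_le Λ A)

end InfVolFermionState

/-! ### The norm of a hopping bond -/

section Hopping

variable {ι : Type*} [LinearOrder ι] [Fintype ι]

open scoped Matrix.Norms.L2Operator in
/-- **A Hubbard bond has norm `≤ 4|t|`**: for orbitals `a σ`, `b σ` (`σ = 0, 1`),
`‖-t Σ_σ ((c_{aσ})ᴴ c_{bσ} + (c_{bσ})ᴴ c_{aσ})‖ ≤ 4|t|` (`‖c‖, ‖c†‖ ≤ 1`). [folklore] -/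
theorem norm_hoppingTerm_le (t : ℝ) (a b : Fin 2 → ι) :
    ‖-(t : ℂ) • ∑ σ : Fin 2,
        ((annihilation (a σ) : Matrix (Finset ι) (Finset ι) ℂ)ᴴ * annihilation (b σ) +
          (annihilation (b σ))ᴴ * annihilation (a σ))‖ ≤ 4 * |t| := by
  have hterm : ∀ i j : ι, ‖((annihilation i : Matrix (Finset ι) (Finset ι) ℂ)ᴴ * annihilation j)‖ ≤ 1 := by
    intro i j
    rw [annihilation_conjTranspose]
    calc _ ≤ ‖(creation i : Matrix (Finset ι) (Finset ι) ℂ)‖ * ‖(annihilation j : Matrix (Finset ι) (Finset ι) ℂ)‖ :=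
          norm_mul_le _ _
      _ ≤ 1 * 1 := mul_le_mul (norm_creation_le_one i) (norm_annihilation_le_one j) (norm_nonneg _) zero_le_one
      _ = 1 := one_mul 1
  rw [norm_smul, norm_neg, Complex.norm_real, Real.norm_eq_abs]
  calc |t| * ‖∑ σ : Fin 2, ((annihilation (a σ) : Matrix (Finset ι) (Finset ι) ℂ)ᴴ * annihilation (b σ) +
        (annihilation (b σ))ᴴ * annihilation (a σ))‖
      ≤ |t| * ∑ σ : Fin 2, ‖((annihilation (a σ) : Matrix (Finset ι) (Finset ι) ℂ)ᴴ * annihilation (b σ) +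
        (annihilation (b σ))ᴴ * annihilation (a σ))‖ :=
        mul_le_mul_of_nonneg_left (norm_sum_le _ _) (abs_nonneg t)
    _ ≤ |t| * ∑ _σ : Fin 2, (2 : ℝ) := by
        refine mul_le_mul_of_nonneg_left (Finset.sum_le_sum fun σ _ => ?_) (abs_nonneg t)
        calc _ ≤ ‖((annihilation (a σ) : Matrix (Finset ι) (Finset ι) ℂ)ᴴ * annihilation (b σ))‖ +
              ‖((annihilation (b σ) : Matrix (Finset ι) (Finset ι) ℂ)ᴴ * annihilation (a σ))‖ := norm_add_le _ _
          _ ≤ 1 + 1 := add_le_add (hterm _ _) (hterm _ _)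
          _ = 2 := by norm_num
    _ = 4 * |t| := by simp; ring

end Hopping

end Literature.MathematicalPhysics.QuantumLattice

end
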